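import Literature.Probability.Percolation.CardyFormulaConformalInvariance
import HarnessLib

/-!
# Smirnov's theorem in Carleson's form, reduced to Lemma 14 of Bollobás–Riordan

Topic `Literature/Probability/Percolation`; family `crit-perc`. Second sibling proof file of
`SmirnovTheorem.lean`, for its named fact **(A)**
`Literature.Probability.Percolation.smirnov_tendsto_triDomainCrossingProb` — Smirnov's theorem in
Carleson's form (Smirnov, C. R. Acad. Sci. Paris 333 (2001), Thm. 1 and Cor.; Bollobás–Riordan,
*Percolation* (2006), Ch. 7, Thm. 2, p. 165, as proved on pp. 202–203 with (3) p. 163): for a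
conformal rectangle `R = (Ω; a', b', c', d')` with a Carleson map `ψ : Ω → Δ(abc)`,
`a', b', c' ↦ a, b, c`, `d' ↦ d ∈ (c, a)`, the critical site-percolation crossing probability
`triDomainCrossingProb R δ` tends to `|d - c| / |a - c|` as `δ → 0⁺`.

The first sibling `SmirnovTheoremProofs.lean` proves (A) from the discrete separating families
(D) and the Jordan curve theorem (`smirnov_tendsto_triDomainCrossingProb_of_separatingFamilies`,
the latter proved: `Literature.Topology.PlaneTopology.JordanCurveTheorem_holds`), and the tree
has since proved (D) from (D′) (`smirnov_exists_separatingFamilies_of_separatingData`,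
`SmirnovSeparatingData.lean`) and (D′) from Lemma 14 alone
(`smirnov_exists_separatingData_of_exists_discreteApprox`, `CardyFormulaConformalInvariance.lean`:
the other four discrete inputs — (40), the estimates of the proof of Claim 23, Claim 10,
Lemma 12 — being discharged, with Lemma 4 and Lemma 13). Those files sit *above*
`SmirnovTheoremProofs.lean` in the import order (`CardyFormulaProofs.lean` imports it), so the
composite reduction and the eventual discharge of (A) cannot be appended there; this file is
their home:

* `smirnov_tendsto_triDomainCrossingProb_of_exists_discreteApprox` — **(A) from Lemma 14
  alone**: Smirnov's theorem in Carleson's form follows from the single remaining named fact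
  `tri_exists_discreteApprox` (`TriApproxDomain.lean`: Bollobás–Riordan Lemma 14, p. 184, with
  the sandwich (19), for anticlockwise Carleson data).

* `smirnov_tendsto_triDomainCrossingProb_holds` — **the discharge of (A)**: Lemma 14 with (19)
  is now a theorem of the tree (`tri_exists_discreteApprox_proof`, `TriApproxDomainAssembly.lean`:
  Bollobás–Riordan p. 195, the diagonal choice `ε₁(δ) → 0` over the level-`ε` collar domains,
  Claim 21), so (A) holds outright, and with it every layer of Bollobás–Riordan's proof of Thm. 2
  in Carleson's form is proved in the tree (axiom closure `propext`, `Classical.choice`,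
  `Quot.sound`).

## References

* B. Bollobás, O. Riordan, *Percolation*, Cambridge University Press (2006), Ch. 7: Thm. 2
  p. 165 (proof pp. 202–203), (3) p. 163, Lemma 14 p. 184 with (19) (proof pp. 184–195),
  §7.2.6 pp. 196–203.
* S. Smirnov, *Critical percolation in the plane: conformal invariance, Cardy's formula, scaling
  limits*, C. R. Acad. Sci. Paris Sér. I Math. 333 (2001) 239–244, Thm. 1 and Cor.

## Mathlib / tree

Tree: `CardyFormulaConformalInvariance.lean`
(`smirnov_exists_separatingData_of_exists_discreteApprox`), `SmirnovSeparatingData.lean`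
(`smirnov_exists_separatingFamilies_of_separatingData`), `SmirnovTheoremProofs.lean`
(`smirnov_tendsto_triDomainCrossingProb_of_separatingFamilies`), `JordanCurveProofs.lean`
(`JordanCurveTheorem_holds`), `TriApproxDomain.lean`
(`tri_exists_discreteApprox`), `TriApproxDomainAssembly.lean` (`tri_exists_discreteApprox_proof`).
-/

namespace Literature.Probability.Percolation

/-- **(A), Smirnov's theorem in Carleson's form, from Lemma 14 alone**: the convergence
`P_{1/2}[C_δ(Ω; a'b' ↔ c'd')] → |d - c| / |a - c|` (`smirnov_tendsto_triDomainCrossingProb`;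
Bollobás–Riordan 2006, Ch. 7, Thm. 2 as proved on pp. 202–203: "`P_δ(G_δ⁻) = f_δ²(z_δ) + o(1)
= h²(φ(P₄)) + o(1)`", and `h²(φ(P₄)) = π(D₄) = x` by (3) p. 163) follows from the discrete
approximation `tri_exists_discreteApprox` (Lemma 14, p. 184, with the sandwich (19)), through
(D′) (`smirnov_exists_separatingData_of_exists_discreteApprox`), (D)
(`smirnov_exists_separatingFamilies_of_separatingData`) and the limit argument of §7.2.6 with
the proved Jordan curve theorem (`smirnov_tendsto_triDomainCrossingProb_of_separatingFamilies`,
`JordanCurveTheorem_holds`).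
[cite: BollobasRiordan2006, Ch. 7 Thm. 2 (p. 165, proof pp. 202–203) and Lemma 14 p. 184] [cite: Smirnov2001, Thm. 1 and Cor.] -/
theorem smirnov_tendsto_triDomainCrossingProb_of_exists_discreteApprox
    (h14 : tri_exists_discreteApprox) : smirnov_tendsto_triDomainCrossingProb :=
  smirnov_tendsto_triDomainCrossingProb_of_separatingFamilies
    (smirnov_exists_separatingFamilies_of_separatingData
      (smirnov_exists_separatingData_of_exists_discreteApprox h14))
    Literature.Topology.PlaneTopology.JordanCurveTheorem_holds

/-- **(A), Smirnov's theorem in Carleson's form, holds** — discharge of the named fact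
`smirnov_tendsto_triDomainCrossingProb` (`SmirnovTheorem.lean`; Smirnov, C. R. Acad. Sci. Paris
333 (2001), Thm. 1 and Cor.; Bollobás–Riordan 2006, Ch. 7, Thm. 2 p. 165 as proved on
pp. 202–203 with (3) p. 163): for every conformal rectangle `R = (Ω; a', b', c', d')`, every
non-degenerate equilateral triangle `abc`, `d ∈ (c, a)` and Carleson map `ψ : Ω → Δ(abc)`
(`a', b', c', d' ↦ a, b, c, d`), the critical site-percolation crossing probability
`triDomainCrossingProb R δ` tends to Carleson's ratio `|d - c| / |a - c|` as `δ → 0⁺`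
("`P_δ(G_δ⁻) = f_δ²(z_δ) + o(1) = h²(φ(P₄)) + o(1)`", p. 203). Obtained from the tree's proof of
Lemma 14 with (19) (`tri_exists_discreteApprox_proof`, `TriApproxDomainAssembly.lean`, proof
p. 195) by `smirnov_tendsto_triDomainCrossingProb_of_exists_discreteApprox`.
[cite: BollobasRiordan2006, Ch. 7 Thm. 2 (p. 165, proof pp. 202–203), (3) p. 163, Lemma 14 p. 184 (proof p. 195)] [cite: Smirnov2001, Thm. 1 and Cor.] -/
theorem smirnov_tendsto_triDomainCrossingProb_holds : smirnov_tendsto_triDomainCrossingProb :=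
  smirnov_tendsto_triDomainCrossingProb_of_exists_discreteApprox tri_exists_discreteApprox_proof

end Literature.Probability.Percolation
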